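import Summits.Ventures.CertifiedManyBodySolver.Downfold.TperpSeam
import Literature.MathematicalPhysics.QuantumLattice.PeriodicCellEnergyMinimisers
import Literature.MathematicalPhysics.QuantumLattice.TrilayerHubbardTTPrimeInequivalentPlanes
import HarnessLib

/-!
# The TRILAYER seam: two one-band boxes (outer planes / inner plane, Hg-1223 class) and their S2 words ⇒
# per-plane energy windows and per-plane word transfer for the periodic ground states of the trilayer crystal

Venture CertifiedManyBodySolver, stage S1 → S2 seam (cell `pub/hubbard-downfold` box schema; the multilayer records hand
over SEPARATE one-band objects per plane type, e.g. Hg-1223 #35 «OP» and «IP», each with its own `U/t`, `tp/t`, `n` and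
the interlayer row `tperp/t`). Written by hubbard-box-p1 (cell `pub/hubbard-fast`, S2 «families of models / interlayer
coupling»); the multilayer twin of `TperpSeam.lean` (uniform / bilayer stackings). It reads the kernel files
`Literature/…/InequivalentLayerStackingTransport`, `TrilayerHubbardTTPrimeInequivalentPlanes`, `PeriodicCellEnergyMinimisers`:
the trilayer crystal `trilayerHubbardTTPrimeViews t t' U ε t⊥ t⊥'` (planes `0, 2` = outer, `1` = inner; ANY site
energies `ε_j`; vertical bonds `t⊥` inside the trilayer, `t⊥'` across), its periodic ground states at their own cell
filling (`IsMinOn` over `periodicStatesAt (stackPeriods 2 2) ρ̄`; they EXIST, `exists_isMinOn_cellEnergy_periodicStatesAt`),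
and the plane marginals `ω.layerMarginal (layerCoset 2 j)` (translation-invariant states of `ℤ²`).

* `holdsOn_trilayer_planeWindows_of_windows` — THE SEAM FOR ENERGY WINDOWS: outer box `B₀` (entries `eU₀, eS₀, eN₀, eZ₀`
  for `U/t`, `tp/t`, `n`, `tperp/t`) and inner box `B₁` (entries `eU₁, eS₁, eN₁`), S2 windows
  `L_i ≤ energyDensityTT' 1 (θ 1) (θ 0) (θ 2) ≤ R_i` on the two delivered boxes. Then on `B₀ × B₁`: for all site energies,
  all `|t⊥|, |t⊥'| ≤ |p₀ tperp/t|`, every periodic ground state of the crystal with planes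
  `(1, p₀ tp/t, p₀ U/t)`, `(1, p₁ tp/t, p₁ U/t)`, `(1, p₀ tp/t, p₀ U/t)` whose plane fillings are `p₀ n`, `p₁ n`, `p₀ n`
  has EACH plane marginal in the energy window `[L_i, R_i + 6·mZ]`, `mZ = max |eZ₀.lo| |eZ₀.hi|`
  (lower: variational principle; upper: the plane-by-plane near-ground-state theorem, allowance `2(2|t⊥|+|t⊥'|) ≤ 6 mZ`).
* `holdsOn_trilayer_planeWords_of_words` — THE SEAM FOR ENERGY-WINDOW WORDS (pairing / correlator bounds of the obs
  cells): words `P₀`, `P₁` issued on the two delivered boxes in the shape «∀ translation-invariant `σ` of `ℤ²` with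
  `ρ(σ) = θ 2` and `e_{Φ(1,θ 1,θ 0)}(σ) ≤ energyDensityTT' 1 (θ 1) (θ 0) (θ 2) + ε'`, `P σ`» with `ε' ≥ 6 mZ` hold for the
  outer-plane marginals (`P₀`) and the inner-plane marginal (`P₁`) of every such ground state.

Everything here is PROVED. HONEST FRAMING: in units of a COMMON nearest-neighbour `t` for the three planes (plane-dependent
absolute `t` goes through `HubbardScaleTransport`); the plane fillings are modelling inputs (the records' per-plane `n` rows)
imposed as hypotheses on the marginals; a downfolded box is a systematic modelling claim (`B.Mem p`); site energies are free;
energies and transferred words only — nothing here is a phase word and no number about any material is certified by this file.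
-/

namespace Summit.Ventures.CertifiedManyBodySolver.Downfold

open NonemptyInterval Literature.MathematicalPhysics.QuantumLattice
  Literature.MathematicalPhysics.QuantumLattice.ThermodynamicLimit Literature.Probability.LatticeModels

/-- The trilayer allowance is controlled by the outer object's `tperp/t` row: `2(2|t⊥| + |t⊥'|) ≤ 6·mZ` when
`|t⊥|, |t⊥'| ≤ |p tperp/t| ≤ mZ`. [folklore] -/
theorem trilayer_allowance_le {eZ : Entry} {z tperp tperp' : ℝ} (hz : eZ.Mem z) (h1 : |tperp| ≤ |z|) (h2 : |tperp'| ≤ |z|) :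
    2 * (2 * |tperp| + |tperp'|) ≤ 6 * ((max |eZ.encl.fst| |eZ.encl.snd| : ℚ) : ℝ) := by
  have hm := Entry.abs_le_of_mem hz
  linarith

/-- **THE TRILAYER SEAM FOR ENERGY WINDOWS.** Outer box `B₀` (`U/t`, `tp/t`, `n`, `tperp/t` entries, `eU₀.lo ≥ 0`,
`0 < eN₀.lo`, `eN₀.hi < 2`), inner box `B₁` (`U/t`, `tp/t`, `n`, same side conditions), S2 windows on both delivered boxes.
On `B₀ × B₁`: for all site energies `ε`, all `|t⊥|, |t⊥'| ≤ |p₀ tperp/t|`, every periodic state of the trilayer crystal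
minimising the cell energy at its own cell filling, with plane fillings `p₀ n` (outer), `p₁ n` (inner), `p₀ n` (outer), has
plane marginals in the windows `[L₀, R₀ + 6 mZ]` (outer planes) and `[L₁, R₁ + 6 mZ]` (inner plane). [folklore] -/
theorem holdsOn_trilayer_planeWindows_of_windows {B₀ B₁ : OneBandBox} {eU₀ eS₀ eN₀ eZ₀ eU₁ eS₁ eN₁ : Entry}
    (hU₀ : B₀ .UOverT = some eU₀) (hS₀ : B₀ .tpOverT = some eS₀) (hN₀ : B₀ .filling = some eN₀)
    (hZ₀ : B₀ .tperpOverT = some eZ₀) (hU₀0 : 0 ≤ eU₀.encl.fst) (hN₀0 : 0 < eN₀.encl.fst) (hN₀2 : eN₀.encl.snd < 2)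
    (hU₁ : B₁ .UOverT = some eU₁) (hS₁ : B₁ .tpOverT = some eS₁) (hN₁ : B₁ .filling = some eN₁)
    (hU₁0 : 0 ≤ eU₁.encl.fst) (hN₁0 : 0 < eN₁.encl.fst) (hN₁2 : eN₁.encl.snd < 2)
    {L₀ R₀ L₁ R₁ : ℝ}
    (hE₀ : ∀ θ ∈ Set.Icc (s2Lo eU₀ eS₀ eN₀) (s2Hi eU₀ eS₀ eN₀),
      L₀ ≤ energyDensityTT' 1 (θ 1) (θ 0) (θ 2) ∧ energyDensityTT' 1 (θ 1) (θ 0) (θ 2) ≤ R₀)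
    (hE₁ : ∀ θ ∈ Set.Icc (s2Lo eU₁ eS₁ eN₁) (s2Hi eU₁ eS₁ eN₁),
      L₁ ≤ energyDensityTT' 1 (θ 1) (θ 0) (θ 2) ∧ energyDensityTT' 1 (θ 1) (θ 0) (θ 2) ≤ R₁) :
    HoldsOn (fun p₀ : OneBandCoord → ℝ => HoldsOn (fun p₁ : OneBandCoord → ℝ =>
      ∀ (ε : Fin 3 → ℝ) (tperp tperp' : ℝ), |tperp| ≤ |p₀ .tperpOverT| → |tperp'| ≤ |p₀ .tperpOverT| →
      ∀ ω : InfVolFermionState 3, ω.IsPeriodic (stackPeriods 2 2) →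
        IsMinOn (fun σ : InfVolFermionState 3 => σ.cellEnergy
          (trilayerHubbardTTPrimeViews ![1, 1, 1] ![p₀ .tpOverT, p₁ .tpOverT, p₀ .tpOverT]
            ![p₀ .UOverT, p₁ .UOverT, p₀ .UOverT] ε tperp tperp') 1)
          (periodicStatesAt (stackPeriods 2 2) (ω.cellFilling (stackPeriods 2 2))) ω →
        (ω.layerMarginal (layerCoset 2 (0 : Fin 3))).density = p₀ .filling →
        (ω.layerMarginal (layerCoset 2 (1 : Fin 3))).density = p₁ .filling →
        (ω.layerMarginal (layerCoset 2 (2 : Fin 3))).density = p₀ .filling →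
          (L₀ ≤ (ω.layerMarginal (layerCoset 2 (0 : Fin 3))).meanEnergy
              (hubbardTTPrimeFermionInteraction 1 (p₀ .tpOverT) (p₀ .UOverT)) 1 ∧
            (ω.layerMarginal (layerCoset 2 (0 : Fin 3))).meanEnergy
              (hubbardTTPrimeFermionInteraction 1 (p₀ .tpOverT) (p₀ .UOverT)) 1 ≤
                R₀ + 6 * ((max |eZ₀.encl.fst| |eZ₀.encl.snd| : ℚ) : ℝ)) ∧
          (L₁ ≤ (ω.layerMarginal (layerCoset 2 (1 : Fin 3))).meanEnergy
              (hubbardTTPrimeFermionInteraction 1 (p₁ .tpOverT) (p₁ .UOverT)) 1 ∧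
            (ω.layerMarginal (layerCoset 2 (1 : Fin 3))).meanEnergy
              (hubbardTTPrimeFermionInteraction 1 (p₁ .tpOverT) (p₁ .UOverT)) 1 ≤
                R₁ + 6 * ((max |eZ₀.encl.fst| |eZ₀.encl.snd| : ℚ) : ℝ)) ∧
          (L₀ ≤ (ω.layerMarginal (layerCoset 2 (2 : Fin 3))).meanEnergy
              (hubbardTTPrimeFermionInteraction 1 (p₀ .tpOverT) (p₀ .UOverT)) 1 ∧
            (ω.layerMarginal (layerCoset 2 (2 : Fin 3))).meanEnergy
              (hubbardTTPrimeFermionInteraction 1 (p₀ .tpOverT) (p₀ .UOverT)) 1 ≤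
                R₀ + 6 * ((max |eZ₀.encl.fst| |eZ₀.encl.snd| : ℚ) : ℝ))) B₁) B₀ := by
  intro p₀ hp₀ p₁ hp₁ ε tperp tperp' ht ht' ω hω hmin hn0 hn1 hn2
  obtain ⟨hu₀, hn₀0, hn₀2⟩ := mem_sideConditions hU₀ hN₀ hU₀0 hN₀0 hN₀2 hp₀
  obtain ⟨hu₁, hn₁0, hn₁2⟩ := mem_sideConditions hU₁ hN₁ hU₁0 hN₁0 hN₁2 hp₁
  have hθ₀ := window_of_mem hU₀ hS₀ hN₀ hE₀ hp₀
  have hθ₁ := window_of_mem hU₁ hS₁ hN₁ hE₁ hp₁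
  have hA := trilayer_allowance_le (hp₀ _ _ hZ₀) ht ht'
  have hU : ∀ j : Fin 3, 0 ≤ (![p₀ .UOverT, p₁ .UOverT, p₀ .UOverT] : Fin 3 → ℝ) j := by
    intro j; fin_cases j <;> simp [hu₀, hu₁]
  -- the plane-by-plane near-ground-state theorem with `δ = 0`
  have hmem : ω ∈ periodicStatesAt (stackPeriods 2 2) (ω.cellFilling (stackPeriods 2 2)) := ⟨hω, rfl⟩
  have hδ : ω.cellEnergy (trilayerHubbardTTPrimeViews ![1, 1, 1] ![p₀ .tpOverT, p₁ .tpOverT, p₀ .tpOverT]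
        ![p₀ .UOverT, p₁ .UOverT, p₀ .UOverT] ε tperp tperp') 1 ≤
      infCellEnergyOn (periodicStatesAt (stackPeriods 2 2) (ω.cellFilling (stackPeriods 2 2)))
        (trilayerHubbardTTPrimeViews ![1, 1, 1] ![p₀ .tpOverT, p₁ .tpOverT, p₀ .tpOverT]
          ![p₀ .UOverT, p₁ .UOverT, p₀ .UOverT] ε tperp tperp') 1 + 0 := by
    rw [add_zero, cellEnergy_eq_infCellEnergyOn_of_isMinOn _ 1 hmem hmin]
  have hTI := fun j : Fin 3 => hω.isTranslationInvariant_layerMarginal (layerCoset 2 j)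
  have hd0 : 0 < (ω.layerMarginal (layerCoset 2 (0 : Fin 3))).density := by rw [hn0]; exact hn₀0
  have hd0' : (ω.layerMarginal (layerCoset 2 (0 : Fin 3))).density < 2 := by rw [hn0]; exact hn₀2
  have hd1 : 0 < (ω.layerMarginal (layerCoset 2 (1 : Fin 3))).density := by rw [hn1]; exact hn₁0
  have hd1' : (ω.layerMarginal (layerCoset 2 (1 : Fin 3))).density < 2 := by rw [hn1]; exact hn₁2
  have hd2 : 0 < (ω.layerMarginal (layerCoset 2 (2 : Fin 3))).density := by rw [hn2]; exact hn₀0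
  have hd2' : (ω.layerMarginal (layerCoset 2 (2 : Fin 3))).density < 2 := by rw [hn2]; exact hn₀2
  have h0 := trilayer_meanEnergy_layerMarginal_le hω ![1, 1, 1] ![p₀ .tpOverT, p₁ .tpOverT, p₀ .tpOverT] ε hU tperp tperp'
    hδ 0 hd0 hd0'
  have h1 := trilayer_meanEnergy_layerMarginal_le hω ![1, 1, 1] ![p₀ .tpOverT, p₁ .tpOverT, p₀ .tpOverT] ε hU tperp tperp'
    hδ 1 hd1 hd1'
  have h2 := trilayer_meanEnergy_layerMarginal_le hω ![1, 1, 1] ![p₀ .tpOverT, p₁ .tpOverT, p₀ .tpOverT] ε hU tperp tperp'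
    hδ 2 hd2 hd2'
  simp only [Matrix.cons_val_zero, Matrix.cons_val_one, Matrix.cons_val_two, Matrix.tail_cons, Matrix.head_cons] at h0 h1 h2
  have l0 := (hTI 0).energyDensityTT'_le_meanEnergy 1 (p₀ .tpOverT) hu₀ hd0 hd0'
  have l1 := (hTI 1).energyDensityTT'_le_meanEnergy 1 (p₁ .tpOverT) hu₁ hd1 hd1'
  have l2 := (hTI 2).energyDensityTT'_le_meanEnergy 1 (p₀ .tpOverT) hu₀ hd2 hd2'
  rw [hn0] at h0 l0
  rw [hn1] at h1 l1
  rw [hn2] at h2 l2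
  refine ⟨⟨by linarith [hθ₀.1], by linarith [hθ₀.2]⟩, ⟨by linarith [hθ₁.1], by linarith [hθ₁.2]⟩,
    ⟨by linarith [hθ₀.1], by linarith [hθ₀.2]⟩⟩

/-- **THE TRILAYER SEAM FOR ENERGY-WINDOW WORDS** (pairing / correlator words of the obs cells, issued per plane type on the
delivered boxes with slack `ε' ≥ 6 mZ`): they hold for the outer-plane marginals (`P₀`) and the inner-plane marginal (`P₁`)
of every periodic ground state of the trilayer crystal with the boxes' plane fillings. [folklore] -/
theorem holdsOn_trilayer_planeWords_of_words {B₀ B₁ : OneBandBox} {eU₀ eS₀ eN₀ eZ₀ eU₁ eS₁ eN₁ : Entry}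
    (hU₀ : B₀ .UOverT = some eU₀) (hS₀ : B₀ .tpOverT = some eS₀) (hN₀ : B₀ .filling = some eN₀)
    (hZ₀ : B₀ .tperpOverT = some eZ₀) (hU₀0 : 0 ≤ eU₀.encl.fst) (hN₀0 : 0 < eN₀.encl.fst) (hN₀2 : eN₀.encl.snd < 2)
    (hU₁ : B₁ .UOverT = some eU₁) (hS₁ : B₁ .tpOverT = some eS₁) (hN₁ : B₁ .filling = some eN₁)
    (hU₁0 : 0 ≤ eU₁.encl.fst) (hN₁0 : 0 < eN₁.encl.fst) (hN₁2 : eN₁.encl.snd < 2)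
    {P₀ P₁ : InfVolFermionState 2 → Prop} {ε' : ℝ} (hε' : 6 * ((max |eZ₀.encl.fst| |eZ₀.encl.snd| : ℚ) : ℝ) ≤ ε')
    (hW₀ : ∀ θ ∈ Set.Icc (s2Lo eU₀ eS₀ eN₀) (s2Hi eU₀ eS₀ eN₀), ∀ σ : InfVolFermionState 2, σ.IsTranslationInvariant →
      σ.density = θ 2 → σ.meanEnergy (hubbardTTPrimeFermionInteraction 1 (θ 1) (θ 0)) 1 ≤
        energyDensityTT' 1 (θ 1) (θ 0) (θ 2) + ε' → P₀ σ)
    (hW₁ : ∀ θ ∈ Set.Icc (s2Lo eU₁ eS₁ eN₁) (s2Hi eU₁ eS₁ eN₁), ∀ σ : InfVolFermionState 2, σ.IsTranslationInvariant →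
      σ.density = θ 2 → σ.meanEnergy (hubbardTTPrimeFermionInteraction 1 (θ 1) (θ 0)) 1 ≤
        energyDensityTT' 1 (θ 1) (θ 0) (θ 2) + ε' → P₁ σ) :
    HoldsOn (fun p₀ : OneBandCoord → ℝ => HoldsOn (fun p₁ : OneBandCoord → ℝ =>
      ∀ (ε : Fin 3 → ℝ) (tperp tperp' : ℝ), |tperp| ≤ |p₀ .tperpOverT| → |tperp'| ≤ |p₀ .tperpOverT| →
      ∀ ω : InfVolFermionState 3, ω.IsPeriodic (stackPeriods 2 2) →
        IsMinOn (fun σ : InfVolFermionState 3 => σ.cellEnergy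
          (trilayerHubbardTTPrimeViews ![1, 1, 1] ![p₀ .tpOverT, p₁ .tpOverT, p₀ .tpOverT]
            ![p₀ .UOverT, p₁ .UOverT, p₀ .UOverT] ε tperp tperp') 1)
          (periodicStatesAt (stackPeriods 2 2) (ω.cellFilling (stackPeriods 2 2))) ω →
        (ω.layerMarginal (layerCoset 2 (0 : Fin 3))).density = p₀ .filling →
        (ω.layerMarginal (layerCoset 2 (1 : Fin 3))).density = p₁ .filling →
        (ω.layerMarginal (layerCoset 2 (2 : Fin 3))).density = p₀ .filling →
          P₀ (ω.layerMarginal (layerCoset 2 (0 : Fin 3))) ∧ P₁ (ω.layerMarginal (layerCoset 2 (1 : Fin 3))) ∧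
            P₀ (ω.layerMarginal (layerCoset 2 (2 : Fin 3)))) B₁) B₀ := by
  intro p₀ hp₀ p₁ hp₁ ε tperp tperp' ht ht' ω hω hmin hn0 hn1 hn2
  obtain ⟨hu₀, hn₀0, hn₀2⟩ := mem_sideConditions hU₀ hN₀ hU₀0 hN₀0 hN₀2 hp₀
  obtain ⟨hu₁, hn₁0, hn₁2⟩ := mem_sideConditions hU₁ hN₁ hU₁0 hN₁0 hN₁2 hp₁
  have hA := trilayer_allowance_le (hp₀ _ _ hZ₀) ht ht'
  have hU : ∀ j : Fin 3, 0 ≤ (![p₀ .UOverT, p₁ .UOverT, p₀ .UOverT] : Fin 3 → ℝ) j := by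
    intro j; fin_cases j <;> simp [hu₀, hu₁]
  have hmem : ω ∈ periodicStatesAt (stackPeriods 2 2) (ω.cellFilling (stackPeriods 2 2)) := ⟨hω, rfl⟩
  have hδ : ω.cellEnergy (trilayerHubbardTTPrimeViews ![1, 1, 1] ![p₀ .tpOverT, p₁ .tpOverT, p₀ .tpOverT]
        ![p₀ .UOverT, p₁ .UOverT, p₀ .UOverT] ε tperp tperp') 1 ≤
      infCellEnergyOn (periodicStatesAt (stackPeriods 2 2) (ω.cellFilling (stackPeriods 2 2)))
        (trilayerHubbardTTPrimeViews ![1, 1, 1] ![p₀ .tpOverT, p₁ .tpOverT, p₀ .tpOverT]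
          ![p₀ .UOverT, p₁ .UOverT, p₀ .UOverT] ε tperp tperp') 1 + 0 := by
    rw [add_zero, cellEnergy_eq_infCellEnergyOn_of_isMinOn _ 1 hmem hmin]
  have hTI := fun j : Fin 3 => hω.isTranslationInvariant_layerMarginal (layerCoset 2 j)
  have hd0 : 0 < (ω.layerMarginal (layerCoset 2 (0 : Fin 3))).density := by rw [hn0]; exact hn₀0
  have hd0' : (ω.layerMarginal (layerCoset 2 (0 : Fin 3))).density < 2 := by rw [hn0]; exact hn₀2
  have hd1 : 0 < (ω.layerMarginal (layerCoset 2 (1 : Fin 3))).density := by rw [hn1]; exact hn₁0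
  have hd1' : (ω.layerMarginal (layerCoset 2 (1 : Fin 3))).density < 2 := by rw [hn1]; exact hn₁2
  have hd2 : 0 < (ω.layerMarginal (layerCoset 2 (2 : Fin 3))).density := by rw [hn2]; exact hn₀0
  have hd2' : (ω.layerMarginal (layerCoset 2 (2 : Fin 3))).density < 2 := by rw [hn2]; exact hn₀2
  have h0 := trilayer_meanEnergy_layerMarginal_le hω ![1, 1, 1] ![p₀ .tpOverT, p₁ .tpOverT, p₀ .tpOverT] ε hU tperp tperp'
    hδ 0 hd0 hd0'
  have h1 := trilayer_meanEnergy_layerMarginal_le hω ![1, 1, 1] ![p₀ .tpOverT, p₁ .tpOverT, p₀ .tpOverT] ε hU tperp tperp'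
    hδ 1 hd1 hd1'
  have h2 := trilayer_meanEnergy_layerMarginal_le hω ![1, 1, 1] ![p₀ .tpOverT, p₁ .tpOverT, p₀ .tpOverT] ε hU tperp tperp'
    hδ 2 hd2 hd2'
  simp only [Matrix.cons_val_zero, Matrix.cons_val_one, Matrix.cons_val_two, Matrix.tail_cons, Matrix.head_cons] at h0 h1 h2
  have hs₀ := s2Coords_mem_Icc hU₀ hS₀ hN₀ hp₀
  have hs₁ := s2Coords_mem_Icc hU₁ hS₁ hN₁ hp₁
  rw [hn0] at h0
  rw [hn1] at h1
  rw [hn2] at h2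
  refine ⟨hW₀ (s2Coords p₀) hs₀ _ (hTI 0) hn0 ?_, hW₁ (s2Coords p₁) hs₁ _ (hTI 1) hn1 ?_, hW₀ (s2Coords p₀) hs₀ _ (hTI 2) hn2 ?_⟩
  · show (ω.layerMarginal (layerCoset 2 (0 : Fin 3))).meanEnergy
        (hubbardTTPrimeFermionInteraction 1 (p₀ .tpOverT) (p₀ .UOverT)) 1 ≤
      energyDensityTT' 1 (p₀ .tpOverT) (p₀ .UOverT) (p₀ .filling) + ε'
    exact h0.trans (by linarith)
  · show (ω.layerMarginal (layerCoset 2 (1 : Fin 3))).meanEnergy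
        (hubbardTTPrimeFermionInteraction 1 (p₁ .tpOverT) (p₁ .UOverT)) 1 ≤
      energyDensityTT' 1 (p₁ .tpOverT) (p₁ .UOverT) (p₁ .filling) + ε'
    exact h1.trans (by linarith)
  · show (ω.layerMarginal (layerCoset 2 (2 : Fin 3))).meanEnergy
        (hubbardTTPrimeFermionInteraction 1 (p₀ .tpOverT) (p₀ .UOverT)) 1 ≤
      energyDensityTT' 1 (p₀ .tpOverT) (p₀ .UOverT) (p₀ .filling) + ε'
    exact h2.trans (by linarith)

end Summit.Ventures.CertifiedManyBodySolver.Downfold
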